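import Literature.NumberTheory.Sieve.HeathBrownCubicRegulator
import Mathlib.NumberTheory.MulChar.Basic
import HarnessLib

/-!
# Heath-Brown's Grössencharaktere `ν₀, ν₁, ν₂` of `ℤ[2^{1/3}]` ((9.2)) as characters of ideals

§9 of D. R. Heath-Brown, *Primes represented by `x³ + 2y³`*, Acta Math. 186 (2001) proves his
Lemma 3.8 (the named fact `HeathBrown2001_lemma_3_8`, in the tree reduced to Lemma 9.2,
`HeathBrown2001_lemma_3_8_of_lemma92`) from Lemma 9.2, and Lemma 9.2 from **Lemma 9.4** — Mitsui's
prime number theorem with Grössencharakteren — by harmonic analysis in the characters (9.2). This seat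
(Lemma 3.8) carries out the reduction *Lemma 9.2 ⇐ Lemma 9.4* (pp. 52–60); the present file supplies
its objects, the characters (p. 52–54, Harman *Prime-Detecting Sieves* (13.6.9)):

> "For any non-zero `β = a + b∛2 + c∛4 ∈ ℤ[∛2]` we shall write `β' = a + bω∛2 + cω²∛4`, where
> `ω = ½(−1 + √−3)`. We then set `χ(−1) = (−1)^s`, `χ(ε₀) = e^{it}`, `ε₀'/|ε₀'| = e^{iu}`,
> `log ε₀ = v`. … `ν₀(β) = χ(β)(β/|β|)^s exp{−itv⁻¹ log|β|}`,
> `ν₁(β) = (ββ'/|ββ'|) exp{−iuv⁻¹ log|β|}`, `ν₂(β) = exp{−2πiv⁻¹ log|β|}`. Then, for each index `i`,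
> the function `ν_i(β)` is completely multiplicative, and has modulus `1` (or possibly `0` when
> `i = 0`). Moreover `ν_i(β₁) = ν_i(β₂)` whenever `β₁` and `β₂` are associates. If `S` is an integral
> ideal generated by `β`, we may then define `ν_i(S) = ν_i(β)`." … "`ν(S) = ν^{(j,k)}(S) =
> ν₀(S)ν₁(S)^jν₂(S)^k`. We shall say that the character `ν(S)` is trivial if it takes the value `1`
> whenever `S` is coprime to `q`."

Content (everything PROVED; definitions with bodies; no named facts):

* `cplxEmb_mulVec` — the complex embedding `β'` of `HeathBrownCubicPolar` is multiplicative on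
  coordinate vectors; the unit data `unitLog = v = log E`, `unitVec = ε̂`, `unitArg = u = arg ε'`
  (for the generating unit `u_E` of `HeathBrownCubicRegulator`, which replaces `ε₀`: every unit is
  `±u_E^n`, `exists_units_eq_unitGen_zpow`; that `E = ε₀` is never needed);
* `nu1`, `nu2` on `ℝ³` (so that `ν_i(𝐱)` makes sense for real vectors, p. 53), multiplicative
  (`nu1_mulVec`, `nu2_mulVec`), even, of modulus `1`, and `= 1` at `ε̂` — hence invariant under
  `𝐱 ↦ ε̂·𝐱` (`nu1_mulVec_unitVec`: Heath-Brown's "`ν_i(𝐱) = ν_i(𝐱')` whenever `𝐱` and `𝐱'` are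
  associates");
* `nu1O`, `nu2O` on `𝓞_K` and `nu0O χ` for a character `χ` of `(𝓞_K/(q))^×` (a `MulChar`, value `0`
  off the units), with Heath-Brown's `s = charSign χ`, `t = charAngle χ` (`χ(−1) = (−1)^s`,
  `χ(u_E) = e^{it}`); all multiplicative on `𝓞_K ∖ {0}` and **equal to `1` on every unit**
  (`apply_units_eq_one`, `nu0O_units`, `nu1O_units`, `nu2O_units`);
* `liftIdealHom` — class number one (`CubeRootTwoFieldPID`): a unit-invariant multiplicative `f` on
  `𝓞_K ∖ {0}` is a homomorphism `Ideal(𝓞_K) →*₀ ℂ`, `S ↦ f(generator)`, `0 ↦ 0`; and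
  **`grossenChar hq χ j k : Ideal (𝓞 K) →*₀ ℂ`**, Heath-Brown's `ν^{(j,k)}` (`j, k ∈ ℤ`), with
  `grossenChar_span : ν^{(j,k)}((β)) = ν₀(β)ν₁(β)^jν₂(β)^k`, `|ν^{(j,k)}| ≤ 1`, `= 0` off the ideals
  coprime to `q` (`grossenChar_eq_zero_of_not_coprime`); the format `Ideal (𝓞 K) →*₀ ℂ` is that of the
  twisted coefficients of `Literature.NumberTheory.LFunctions.TwistedDedekindCoefficients`;
* `IsTrivialMod q ν` (the printed notion of triviality) and the easy direction
  `isTrivialMod_grossenChar_one`: `χ = χ₀`, `j = k = 0` gives a trivial character (then `s = t = 0`,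
  `charSign_one`, `charAngle_one`). The converse is proved in the sequel file.

The statement of Lemma 9.4 (p. 55) that the reduction will CONSUME as a hypothesis, in these terms:
for every `A > 0` there are `c > 0`, `C`, `z₀` such that for `z ≥ z₀`, `1 ≤ q ≤ (log z)^A`, every
`χ mod q` and all `j, k ∈ ℤ` with `|j|, |k| ≤ exp(c√(log z))` for which `grossenChar hq χ j k` is not
`IsTrivialMod q`, `|∑_{N(P) ≤ z} grossenChar hq χ j k P| ≤ C z exp(−c√(log z))` (sum over prime ideals).

## References

* D. R. Heath-Brown, *Primes represented by `x³ + 2y³`*, Acta Math. 186 (2001), 1–84, §9 pp. 52–55,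
  (9.1), (9.2), Lemma 9.4. [cite: HeathBrownActa2001, §9 (9.2)]
* G. Harman, *Prime-Detecting Sieves*, LMS Monographs 33 (2007), §13.6, (13.6.9), Lemma 13.19.
  [cite: Harman2007, §13.6 (13.6.9)]
* E. Hecke, *Eine neue Art von Zetafunktionen und ihre Beziehungen zur Verteilung der Primzahlen II*,
  Math. Z. 6 (1920), 11–51. [folklore]

## Mathlib / tree search

Tree: `HeathBrownCubicPolar` (`cplxEmb`, `cplxEmb_re/im`, `ell_mul_normSq_cplxEmb`), `HeathBrownCubicWindow`
(`ell`, `mulVec`, `imulVec`, `castVec_imulVec`, `ell_mulVec`, `ell_neg`, `coordVec`, `coordVec_mul`, `coordVec_neg`,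
`ellO`, `ellO_mul`, `ellO_neg`, `ellO_ne_zero`, `normForm_eq_one_of_isUnit`, `normForm_coordVec_ne_zero`),
`HeathBrownCubicRegulator` (`unitGen`, `ellO_unitGen`, `exists_units_eq_unitGen_zpow`), `CubeRootTwoFieldPID`
(`instIsPrincipalIdealRing`). Mathlib: `MulChar` (`map_nonunit`, `MulChar.one_apply`), `Ideal.span_singleton_generator`,
`Ideal.span_singleton_eq_span_singleton`, `Ideal.sup_eq_top_iff_isCoprime`, `Ideal.finiteQuotientOfFreeOfNeBot`,
`pow_card_eq_one'`, `Complex.norm_mul_exp_arg_mul_I`, `Complex.exp_int_mul_two_pi_mul_I`. No Grössencharakter of a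
cubic field in Mathlib/tree (`lean search 'rossenchar|nu1O|HeckeChar.*cubic'`; `GaloisRepresentations.HeckeCharacter`
is the idelic notion, without these explicit formulas).
-/

noncomputable section

open Polynomial NumberField Finset Complex

namespace Literature.NumberTheory.Sieve.CubicSieve

open LFunctions.CubeRootTwoField CubicPrimes

/-! ### The complex embedding is multiplicative -/

/-- **`β' ` is multiplicative on coordinate vectors**: `cplxEmb (a·b) = cplxEmb a · cplxEmb b` (a
polynomial identity modulo `ρ³ = 2`, `(√3)² = 3`). [folklore] -/
theorem cplxEmb_mulVec (a b : ℝ × ℝ × ℝ) : cplxEmb (mulVec a b) = cplxEmb a * cplxEmb b := by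
  have hρ : rho ^ 3 = 2 := rho_pow_three
  have hs : Real.sqrt 3 ^ 2 = 3 := Real.sq_sqrt (by norm_num)
  apply Complex.ext
  · simp only [cplxEmb_re, cplxEmb_im, mulVec, Complex.mul_re]
    linear_combination (-((a.2.1 * b.2.2 + a.2.2 * b.2.1) - a.2.2 * b.2.2 * rho / 2)) * hρ +
      ((a.2.1 * b.2.1 * rho ^ 2 - (a.2.1 * b.2.2 + a.2.2 * b.2.1) * rho ^ 3 + a.2.2 * b.2.2 * rho ^ 4) / 4) * hs
  · simp only [cplxEmb_re, cplxEmb_im, mulVec, Complex.mul_im]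
    linear_combination (-(a.2.2 * b.2.2 * rho * Real.sqrt 3 / 2)) * hρ

/-- `cplxEmb (−p) = −cplxEmb p`. [folklore] -/
theorem cplxEmb_neg (p : ℝ × ℝ × ℝ) : cplxEmb (-p) = -cplxEmb p := by
  apply Complex.ext <;> simp <;> ring

/-- `castVec (−v) = −castVec v`. [folklore] -/
theorem castVec_neg (v : ℤ × ℤ × ℤ) : castVec (-v) = -castVec v := by
  simp only [castVec, Prod.fst_neg, Prod.snd_neg, Int.cast_neg]; rfl

/-- `mulVec (1,0,0) p = p`. [folklore] -/
theorem mulVec_one_left (p : ℝ × ℝ × ℝ) : mulVec ((1 : ℝ), (0 : ℝ), (0 : ℝ)) p = p := by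
  simp [mulVec]

/-- If `N(p) ≠ 0` then `β(p) ≠ 0`. [folklore] -/
theorem ell_ne_zero_of_normForm_ne_zero {p : ℝ × ℝ × ℝ} (h : normForm p ≠ 0) : ell p ≠ 0 := by
  intro h0; apply h; rw [← ell_mul_quadQ, h0, zero_mul]

/-- If `N(p) ≠ 0` then `β'(p) ≠ 0`. [folklore] -/
theorem cplxEmb_ne_zero_of_normForm_ne_zero {p : ℝ × ℝ × ℝ} (h : normForm p ≠ 0) : cplxEmb p ≠ 0 := by
  intro h0; apply h; rw [← ell_mul_normSq_cplxEmb, h0, Complex.normSq_zero, mul_zero]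

/-! ### The unit data `v = log E`, `ε̂`, `u = arg ε'` -/

/-- **`v = log E`** (`= log ε₀`, the regulator; Heath-Brown's `v`, p. 52). [cite: HeathBrownActa2001, §9 p. 52] -/
def unitLog : ℝ := Real.log unitE

/-- `v > 0`. [folklore] -/
theorem unitLog_pos : 0 < unitLog := Real.log_pos one_lt_unitE

/-- The coordinate vector `ε̂` of the generating unit `u_E`. [folklore] -/
def unitVec : ℝ × ℝ × ℝ := castVec (coordVec (unitGen : 𝓞 K))

/-- `β(ε̂) = E`. [folklore] -/
theorem ell_unitVec : ell unitVec = unitE := ellO_unitGen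

/-- `N(ε̂) = 1`. [folklore] -/
theorem normForm_unitVec : normForm unitVec = 1 :=
  (normForm_eq_one_of_isUnit (Units.isUnit unitGen) (by rw [ellO_unitGen]; exact unitE_pos)).1

/-- `β'(ε̂) ≠ 0`. [folklore] -/
theorem cplxEmb_unitVec_ne_zero : cplxEmb unitVec ≠ 0 :=
  cplxEmb_ne_zero_of_normForm_ne_zero (by rw [normForm_unitVec]; exact one_ne_zero)

/-- **`u = arg ε'`**: the angle of the complex embedding of the generating unit ("`ε₀'/|ε₀'| = e^{iu}`",
p. 52). [cite: HeathBrownActa2001, §9 p. 52] -/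
def unitArg : ℝ := Complex.arg (cplxEmb unitVec)

/-- `ε'/|ε'| = e^{iu}`. [cite: HeathBrownActa2001, §9 p. 52] -/
theorem cplxEmb_unitVec_div_norm :
    cplxEmb unitVec / (‖cplxEmb unitVec‖ : ℂ) = Complex.exp (unitArg * Complex.I) := by
  have h := Complex.norm_mul_exp_arg_mul_I (cplxEmb unitVec)
  have hn : (‖cplxEmb unitVec‖ : ℂ) ≠ 0 := by
    rw [Ne, Complex.ofReal_eq_zero, norm_eq_zero]; exact cplxEmb_unitVec_ne_zero
  rw [div_eq_iff hn, unitArg, mul_comm, h]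

/-! ### `ν₂` and `ν₁` on coordinate vectors ((9.2), p. 53) -/

/-- **`ν₂(𝐱) = exp(−2πi v⁻¹ log|β(𝐱)|)`** for a coordinate vector `𝐱` (p. 53; `β(𝐱) = x₁ + x₂∛2 + x₃∛4`).
[cite: HeathBrownActa2001, §9 (9.2)] -/
def nu2 (p : ℝ × ℝ × ℝ) : ℂ :=
  Complex.exp ((-(2 * Real.pi * (Real.log |ell p| / unitLog)) : ℝ) * Complex.I)

/-- **`ν₁(𝐱) = (β(𝐱)β'(𝐱)/|β(𝐱)β'(𝐱)|) exp(−iu v⁻¹ log|β(𝐱)|)`** (p. 53). [cite: HeathBrownActa2001, §9 (9.2)] -/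
def nu1 (p : ℝ × ℝ × ℝ) : ℂ :=
  ((ell p : ℂ) * cplxEmb p) / (‖(ell p : ℂ) * cplxEmb p‖ : ℂ) *
    Complex.exp ((-(unitArg * (Real.log |ell p| / unitLog)) : ℝ) * Complex.I)

/-- `|ν₂| = 1`. [cite: HeathBrownActa2001, §9 p. 53] -/
theorem norm_nu2 (p : ℝ × ℝ × ℝ) : ‖nu2 p‖ = 1 := by
  rw [nu2, Complex.norm_exp_ofReal_mul_I]

/-- `|ν₁| = 1` when `N(𝐱) ≠ 0`. [cite: HeathBrownActa2001, §9 p. 53] -/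
theorem norm_nu1 {p : ℝ × ℝ × ℝ} (h : normForm p ≠ 0) : ‖nu1 p‖ = 1 := by
  have h1 : (ell p : ℂ) * cplxEmb p ≠ 0 := mul_ne_zero
    (Complex.ofReal_ne_zero.mpr (ell_ne_zero_of_normForm_ne_zero h)) (cplxEmb_ne_zero_of_normForm_ne_zero h)
  rw [nu1, norm_mul, Complex.norm_exp_ofReal_mul_I, mul_one, norm_div, Complex.norm_real, norm_norm,
    div_self (norm_ne_zero_iff.mpr h1)]

/-- **`ν₂` is multiplicative** (for `β(a), β(b) ≠ 0`). [cite: HeathBrownActa2001, §9 p. 53] -/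
theorem nu2_mulVec {a b : ℝ × ℝ × ℝ} (ha : ell a ≠ 0) (hb : ell b ≠ 0) :
    nu2 (mulVec a b) = nu2 a * nu2 b := by
  rw [nu2, nu2, nu2, ← Complex.exp_add, ell_mulVec, abs_mul, Real.log_mul (abs_ne_zero.mpr ha) (abs_ne_zero.mpr hb)]
  congr 1
  push_cast
  ring

/-- **`ν₁` is multiplicative** (for `N(a), N(b) ≠ 0`). [cite: HeathBrownActa2001, §9 p. 53] -/
theorem nu1_mulVec {a b : ℝ × ℝ × ℝ} (ha : normForm a ≠ 0) (hb : normForm b ≠ 0) :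
    nu1 (mulVec a b) = nu1 a * nu1 b := by
  have ha1 := ell_ne_zero_of_normForm_ne_zero ha
  have hb1 := ell_ne_zero_of_normForm_ne_zero hb
  have hA : (ell a : ℂ) * cplxEmb a ≠ 0 :=
    mul_ne_zero (Complex.ofReal_ne_zero.mpr ha1) (cplxEmb_ne_zero_of_normForm_ne_zero ha)
  have hB : (ell b : ℂ) * cplxEmb b ≠ 0 :=
    mul_ne_zero (Complex.ofReal_ne_zero.mpr hb1) (cplxEmb_ne_zero_of_normForm_ne_zero hb)
  have hA' : (‖(ell a : ℂ) * cplxEmb a‖ : ℂ) ≠ 0 := by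
    rw [Ne, Complex.ofReal_eq_zero, norm_eq_zero]; exact hA
  have hB' : (‖(ell b : ℂ) * cplxEmb b‖ : ℂ) ≠ 0 := by
    rw [Ne, Complex.ofReal_eq_zero, norm_eq_zero]; exact hB
  have hexp : Complex.exp ((-(unitArg * (Real.log |ell (mulVec a b)| / unitLog)) : ℝ) * Complex.I) =
      Complex.exp ((-(unitArg * (Real.log |ell a| / unitLog)) : ℝ) * Complex.I) *
        Complex.exp ((-(unitArg * (Real.log |ell b| / unitLog)) : ℝ) * Complex.I) := by
    rw [← Complex.exp_add, ell_mulVec, abs_mul, Real.log_mul (abs_ne_zero.mpr ha1) (abs_ne_zero.mpr hb1)]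
    congr 1; push_cast; ring
  have hprod : (ell (mulVec a b) : ℂ) * cplxEmb (mulVec a b) =
      ((ell a : ℂ) * cplxEmb a) * ((ell b : ℂ) * cplxEmb b) := by
    rw [ell_mulVec, cplxEmb_mulVec]; push_cast; ring
  rw [nu1, nu1, nu1, hexp, hprod, norm_mul, Complex.ofReal_mul]
  field_simp

/-- `ν₂(−𝐱) = ν₂(𝐱)`. [cite: HeathBrownActa2001, §9 p. 53] -/
theorem nu2_neg (p : ℝ × ℝ × ℝ) : nu2 (-p) = nu2 p := by
  rw [nu2, nu2, ell_neg, abs_neg]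

/-- `ν₁(−𝐱) = ν₁(𝐱)`. [cite: HeathBrownActa2001, §9 p. 53] -/
theorem nu1_neg (p : ℝ × ℝ × ℝ) : nu1 (-p) = nu1 p := by
  rw [nu1, nu1, ell_neg, cplxEmb_neg, abs_neg, Complex.ofReal_neg, neg_mul_neg]

/-- `ν₂(ε̂) = 1` (`log E / v = 1`). [cite: HeathBrownActa2001, §9 p. 53] -/
theorem nu2_unitVec : nu2 unitVec = 1 := by
  rw [nu2, ell_unitVec, abs_of_pos unitE_pos, show Real.log unitE / unitLog = 1 from
    div_self unitLog_pos.ne']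
  have : ((-(2 * Real.pi * 1) : ℝ) : ℂ) * Complex.I = (-1 : ℤ) * (2 * Real.pi * Complex.I) := by
    push_cast; ring
  rw [this, Complex.exp_int_mul_two_pi_mul_I]

/-- `ν₁(ε̂) = 1` (`ε'/|ε'| = e^{iu}` cancels `exp(−iu)`). [cite: HeathBrownActa2001, §9 p. 53] -/
theorem nu1_unitVec : nu1 unitVec = 1 := by
  have hE := unitE_pos
  rw [nu1, ell_unitVec, abs_of_pos hE, show Real.log unitE / unitLog = 1 from div_self unitLog_pos.ne',
    mul_one, norm_mul, Complex.norm_real, Real.norm_eq_abs, abs_of_pos hE, Complex.ofReal_mul,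
    mul_div_mul_left _ _ (Complex.ofReal_ne_zero.mpr hE.ne'), cplxEmb_unitVec_div_norm, ← Complex.exp_add]
  convert Complex.exp_zero using 2
  push_cast; ring

/-- **`ν₂` is invariant under the generating unit**: `ν₂(ε̂·𝐱) = ν₂(𝐱)` (`β(𝐱) ≠ 0`).
[cite: HeathBrownActa2001, §9 p. 53] -/
theorem nu2_mulVec_unitVec {p : ℝ × ℝ × ℝ} (hp : ell p ≠ 0) : nu2 (mulVec unitVec p) = nu2 p := by
  rw [nu2_mulVec (by rw [ell_unitVec]; exact unitE_pos.ne') hp, nu2_unitVec, one_mul]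

/-- **`ν₁` is invariant under the generating unit**: `ν₁(ε̂·𝐱) = ν₁(𝐱)` (`N(𝐱) ≠ 0`).
[cite: HeathBrownActa2001, §9 p. 53] -/
theorem nu1_mulVec_unitVec {p : ℝ × ℝ × ℝ} (hp : normForm p ≠ 0) : nu1 (mulVec unitVec p) = nu1 p := by
  rw [nu1_mulVec (by rw [normForm_unitVec]; exact one_ne_zero) hp, nu1_unitVec, one_mul]

/-! ### `ν₁, ν₂` on `𝓞_K = ℤ[2^{1/3}]`: multiplicative, `1` on units -/

/-- The real coordinate vector `β̂ ∈ ℝ³` of `β ∈ 𝓞_K`. [folklore] -/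
def realVec (β : 𝓞 K) : ℝ × ℝ × ℝ := castVec (coordVec β)

/-- `realVec` is multiplicative (for `mulVec`). [folklore] -/
theorem realVec_mul (β γ : 𝓞 K) : realVec (β * γ) = mulVec (realVec β) (realVec γ) := by
  rw [realVec, coordVec_mul, castVec_imulVec]; rfl

/-- `realVec (−β) = −realVec β`. [folklore] -/
theorem realVec_neg (β : 𝓞 K) : realVec (-β) = -realVec β := by
  rw [realVec, coordVec_neg, castVec_neg]; rfl

/-- `realVec 1 = (1, 0, 0)`. [folklore] -/
@[simp] theorem realVec_one : realVec (1 : 𝓞 K) = ((1 : ℝ), (0 : ℝ), (0 : ℝ)) := by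
  simp [realVec, castVec]

/-- `realVec (coordElt v) = castVec v`. [folklore] -/
@[simp] theorem realVec_coordElt (v : ℤ × ℤ × ℤ) : realVec (coordElt v) = castVec v := by
  simp [realVec]

/-- `N(β̂) ≠ 0` for `β ≠ 0`. [folklore] -/
theorem normForm_realVec_ne_zero {β : 𝓞 K} (hβ : β ≠ 0) : normForm (realVec β) ≠ 0 :=
  normForm_coordVec_ne_zero hβ

/-- `β(β̂) = ellO β`. [folklore] -/
theorem ell_realVec (β : 𝓞 K) : ell (realVec β) = ellO β := rfl

/-- `realVec u_E = ε̂`. [folklore] -/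
theorem realVec_unitGen : realVec (unitGen : 𝓞 K) = unitVec := rfl

/-- `ν₁(1,0,0) = 1`. [folklore] -/
theorem nu1_one : nu1 ((1 : ℝ), (0 : ℝ), (0 : ℝ)) = 1 := by
  have h1 : cplxEmb ((1 : ℝ), (0 : ℝ), (0 : ℝ)) = 1 := by apply Complex.ext <;> simp
  simp [nu1, ell, h1]

/-- `ν₂(1,0,0) = 1`. [folklore] -/
theorem nu2_one : nu2 ((1 : ℝ), (0 : ℝ), (0 : ℝ)) = 1 := by
  simp [nu2, ell]

/-- **`ν₁` on `𝓞_K`**: `ν₁(β) = ν₁(β̂)`. [cite: HeathBrownActa2001, §9 (9.2)] -/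
def nu1O (β : 𝓞 K) : ℂ := nu1 (realVec β)

/-- **`ν₂` on `𝓞_K`**: `ν₂(β) = ν₂(β̂)`. [cite: HeathBrownActa2001, §9 (9.2)] -/
def nu2O (β : 𝓞 K) : ℂ := nu2 (realVec β)

/-- `ν₁` is multiplicative on `𝓞_K ∖ {0}`. [cite: HeathBrownActa2001, §9 p. 53] -/
theorem nu1O_mul {β γ : 𝓞 K} (hβ : β ≠ 0) (hγ : γ ≠ 0) : nu1O (β * γ) = nu1O β * nu1O γ := by
  rw [nu1O, realVec_mul, nu1_mulVec (normForm_realVec_ne_zero hβ) (normForm_realVec_ne_zero hγ)]; rfl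

/-- `ν₂` is multiplicative on `𝓞_K ∖ {0}`. [cite: HeathBrownActa2001, §9 p. 53] -/
theorem nu2O_mul {β γ : 𝓞 K} (hβ : β ≠ 0) (hγ : γ ≠ 0) : nu2O (β * γ) = nu2O β * nu2O γ := by
  rw [nu2O, realVec_mul, nu2_mulVec (ell_ne_zero_of_normForm_ne_zero (normForm_realVec_ne_zero hβ))
    (ell_ne_zero_of_normForm_ne_zero (normForm_realVec_ne_zero hγ))]; rfl

/-- `ν₁(−β) = ν₁(β)`. [cite: HeathBrownActa2001, §9 p. 53] -/
theorem nu1O_neg (β : 𝓞 K) : nu1O (-β) = nu1O β := by rw [nu1O, realVec_neg, nu1_neg]; rfl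

/-- `ν₂(−β) = ν₂(β)`. [cite: HeathBrownActa2001, §9 p. 53] -/
theorem nu2O_neg (β : 𝓞 K) : nu2O (-β) = nu2O β := by rw [nu2O, realVec_neg, nu2_neg]; rfl

/-- `ν₁(1) = 1`. [folklore] -/
@[simp] theorem nu1O_one : nu1O 1 = 1 := by rw [nu1O, realVec_one, nu1_one]

/-- `ν₂(1) = 1`. [folklore] -/
@[simp] theorem nu2O_one : nu2O 1 = 1 := by rw [nu2O, realVec_one, nu2_one]

/-- `ν₁(u_E) = 1`. [cite: HeathBrownActa2001, §9 p. 53] -/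
theorem nu1O_unitGen : nu1O (unitGen : 𝓞 K) = 1 := nu1_unitVec

/-- `ν₂(u_E) = 1`. [cite: HeathBrownActa2001, §9 p. 53] -/
theorem nu2O_unitGen : nu2O (unitGen : 𝓞 K) = 1 := nu2_unitVec

/-- `|ν₁(β)| = 1` for `β ≠ 0`. [cite: HeathBrownActa2001, §9 p. 53] -/
theorem norm_nu1O {β : 𝓞 K} (hβ : β ≠ 0) : ‖nu1O β‖ = 1 := norm_nu1 (normForm_realVec_ne_zero hβ)

/-- `|ν₂(β)| = 1`. [cite: HeathBrownActa2001, §9 p. 53] -/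
theorem norm_nu2O (β : 𝓞 K) : ‖nu2O β‖ = 1 := norm_nu2 _

/-- **A multiplicative function on `𝓞_K ∖ {0}` which is even and `1` at `u_E` is `1` on all units**
(every unit is `±u_E^n`, `exists_units_eq_unitGen_zpow`). [folklore] -/
theorem apply_units_eq_one {f : 𝓞 K → ℂ} (hmul : ∀ β γ : 𝓞 K, β ≠ 0 → γ ≠ 0 → f (β * γ) = f β * f γ)
    (hone : f 1 = 1) (hneg : ∀ β, f (-β) = f β) (hgen : f unitGen = 1) (u : (𝓞 K)ˣ) :
    f (u : 𝓞 K) = 1 := by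
  -- powers of `u_E`
  have hpow : ∀ n : ℕ, f ((unitGen ^ n : (𝓞 K)ˣ) : 𝓞 K) = 1 := by
    intro n
    induction n with
    | zero => simpa using hone
    | succ n ih =>
        rw [pow_succ, Units.val_mul, hmul _ _ (Units.ne_zero _) (Units.ne_zero _), ih, hgen, one_mul]
  have hinv : ∀ w : (𝓞 K)ˣ, f (w : 𝓞 K) = 1 → f ((w⁻¹ : (𝓞 K)ˣ) : 𝓞 K) = 1 := by
    intro w hw
    have h := hmul (w : 𝓞 K) ((w⁻¹ : (𝓞 K)ˣ) : 𝓞 K) (Units.ne_zero _) (Units.ne_zero _)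
    rw [Units.mul_inv, hone, hw, one_mul] at h
    exact h.symm
  have hzpow : ∀ n : ℤ, f ((unitGen ^ n : (𝓞 K)ˣ) : 𝓞 K) = 1 := by
    intro n
    obtain ⟨k, rfl | rfl⟩ := Int.eq_nat_or_neg n
    · rw [zpow_natCast]; exact hpow k
    · rw [zpow_neg, zpow_natCast]; exact hinv _ (hpow k)
  obtain ⟨n, h | h⟩ := exists_units_eq_unitGen_zpow u
  · rw [h]; exact hzpow n
  · rw [h, Units.val_neg, hneg]; exact hzpow n

/-- **`ν₁` is `1` on units**, hence a function of the ideal `(β)`. [cite: HeathBrownActa2001, §9 p. 53] -/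
theorem nu1O_units (u : (𝓞 K)ˣ) : nu1O (u : 𝓞 K) = 1 :=
  apply_units_eq_one (fun _ _ => nu1O_mul) nu1O_one nu1O_neg nu1O_unitGen u

/-- **`ν₂` is `1` on units.** [cite: HeathBrownActa2001, §9 p. 53] -/
theorem nu2O_units (u : (𝓞 K)ˣ) : nu2O (u : 𝓞 K) = 1 :=
  apply_units_eq_one (fun _ _ => nu2O_mul) nu2O_one nu2O_neg nu2O_unitGen u

/-! ### `ν₀` from a character `χ` modulo `q` ((9.2)) -/

/-- The residue ring `𝓞_K/(q)`. [folklore] -/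
abbrev QuotMod (q : ℕ) : Type := 𝓞 K ⧸ Ideal.span {((q : ℕ) : 𝓞 K)}

/-- The reduction map `𝓞_K → 𝓞_K/(q)`. [folklore] -/
abbrev toQuotMod (q : ℕ) : 𝓞 K →+* QuotMod q := Ideal.Quotient.mk _

variable {q : ℕ}

/-- For `q ≥ 1` the ideal `(q)` is non-zero. [folklore] -/
theorem span_natCast_ne_bot_of_one_le (hq : 1 ≤ q) : Ideal.span {((q : ℕ) : 𝓞 K)} ≠ ⊥ := by
  rw [Ne, Ideal.span_singleton_eq_bot]
  exact_mod_cast (Nat.one_le_iff_ne_zero.mp hq)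

/-- `𝓞_K/(q)` is finite for `q ≥ 1`. [folklore] -/
theorem finite_quotMod (hq : 1 ≤ q) : Finite (QuotMod q) :=
  Ideal.finiteQuotientOfFreeOfNeBot _ (span_natCast_ne_bot_of_one_le hq)

/-- **Values of a character `χ mod q` on units have modulus `1`** (they are roots of unity).
[folklore] -/
theorem norm_mulChar_apply_units (hq : 1 ≤ q) (χ : MulChar (QuotMod q) ℂ) (x : (QuotMod q)ˣ) :
    ‖χ (x : QuotMod q)‖ = 1 := by
  haveI := finite_quotMod hq
  haveI : Finite (QuotMod q)ˣ := inferInstance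
  have hcard : 0 < Nat.card (QuotMod q)ˣ := Nat.card_pos
  have h1 : (x : QuotMod q) ^ Nat.card (QuotMod q)ˣ = 1 := by
    rw [← Units.val_pow_eq_pow_val, pow_card_eq_one', Units.val_one]
  have h2 : χ (x : QuotMod q) ^ Nat.card (QuotMod q)ˣ = 1 := by
    rw [← map_pow, h1, MulChar.map_one]
  have h3 : ‖χ (x : QuotMod q)‖ ^ Nat.card (QuotMod q)ˣ = 1 := by rw [← norm_pow, h2, norm_one]
  exact (pow_eq_one_iff_of_nonneg (norm_nonneg _) hcard.ne').mp h3

/-- `χ(u mod q)` has modulus `1` for a unit `u` of `𝓞_K`. [folklore] -/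
theorem norm_mulChar_apply_coe_units (hq : 1 ≤ q) (χ : MulChar (QuotMod q) ℂ) (u : (𝓞 K)ˣ) :
    ‖χ (toQuotMod q (u : 𝓞 K))‖ = 1 := by
  have := norm_mulChar_apply_units hq χ (Units.map (toQuotMod q).toMonoidHom u)
  simpa using this

/-- `χ(−1) = ±1`. [folklore] -/
theorem mulChar_neg_one_sq (χ : MulChar (QuotMod q) ℂ) : χ (-1) = 1 ∨ χ (-1) = -1 := by
  have h : χ (-1) * χ (-1) = 1 := by rw [← map_mul, neg_one_mul, neg_neg, MulChar.map_one]
  exact mul_self_eq_one_iff.mp h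

/-- **Heath-Brown's exponent `s = s(χ) ∈ {0, 1}`**, defined by `χ(−1) = (−1)^s` (p. 52).
[cite: HeathBrownActa2001, §9 p. 52] -/
def charSign (χ : MulChar (QuotMod q) ℂ) : ℕ := if χ (-1) = 1 then 0 else 1

/-- `χ(−1) = (−1)^s`. [cite: HeathBrownActa2001, §9 p. 52] -/
theorem mulChar_neg_one_eq (χ : MulChar (QuotMod q) ℂ) : χ (-1) = (-1) ^ charSign χ := by
  unfold charSign
  rcases mulChar_neg_one_sq χ with h | h
  · rw [if_pos h, pow_zero]; exact h
  · rw [if_neg (by rw [h]; norm_num), pow_one]; exact h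

/-- `s ≤ 1`. [folklore] -/
theorem charSign_le_one (χ : MulChar (QuotMod q) ℂ) : charSign χ ≤ 1 := by
  unfold charSign; split_ifs <;> simp

/-- **Heath-Brown's angle `t = t(χ)`**, defined by `χ(ε₀) = e^{it}` (p. 52); here `t = arg χ(u_E mod q)`
(`t ∈ (−π, π]` rather than `[0, 2π)`, immaterial). [cite: HeathBrownActa2001, §9 p. 52] -/
def charAngle (χ : MulChar (QuotMod q) ℂ) : ℝ := Complex.arg (χ (toQuotMod q (unitGen : 𝓞 K)))

/-- `|t| ≤ π`. [folklore] -/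
theorem abs_charAngle_le (χ : MulChar (QuotMod q) ℂ) : |charAngle χ| ≤ Real.pi := Complex.abs_arg_le_pi _

/-- `χ(u_E mod q) = e^{it}`. [cite: HeathBrownActa2001, §9 p. 52] -/
theorem mulChar_unitGen_eq (hq : 1 ≤ q) (χ : MulChar (QuotMod q) ℂ) :
    χ (toQuotMod q (unitGen : 𝓞 K)) = Complex.exp (charAngle χ * Complex.I) := by
  have h := Complex.norm_mul_exp_arg_mul_I (χ (toQuotMod q (unitGen : 𝓞 K)))
  rw [norm_mulChar_apply_coe_units hq, Complex.ofReal_one, one_mul] at h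
  exact h.symm

/-- **`ν₀(β) = χ(β) (β/|β|)^s exp(−it v⁻¹ log|β|)`** ((9.2), with `β` the real embedding `ellO β`;
Harman (13.6.9)). [cite: HeathBrownActa2001, §9 (9.2)] -/
def nu0O (χ : MulChar (QuotMod q) ℂ) (β : 𝓞 K) : ℂ :=
  χ (toQuotMod q β) * ((ellO β / |ellO β| : ℝ) : ℂ) ^ charSign χ *
    Complex.exp ((-(charAngle χ * (Real.log |ellO β| / unitLog)) : ℝ) * Complex.I)

/-- `ν₀` is multiplicative on `𝓞_K ∖ {0}`. [cite: HeathBrownActa2001, §9 p. 53] -/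
theorem nu0O_mul (χ : MulChar (QuotMod q) ℂ) {β γ : 𝓞 K} (hβ : β ≠ 0) (hγ : γ ≠ 0) :
    nu0O χ (β * γ) = nu0O χ β * nu0O χ γ := by
  have hb := ellO_ne_zero hβ
  have hc := ellO_ne_zero hγ
  have hsign : ((ellO (β * γ) / |ellO (β * γ)| : ℝ) : ℂ) =
      ((ellO β / |ellO β| : ℝ) : ℂ) * ((ellO γ / |ellO γ| : ℝ) : ℂ) := by
    rw [← Complex.ofReal_mul, ellO_mul, abs_mul, div_mul_div_comm]
  have hexp : Complex.exp ((-(charAngle χ * (Real.log |ellO (β * γ)| / unitLog)) : ℝ) * Complex.I) =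
      Complex.exp ((-(charAngle χ * (Real.log |ellO β| / unitLog)) : ℝ) * Complex.I) *
        Complex.exp ((-(charAngle χ * (Real.log |ellO γ| / unitLog)) : ℝ) * Complex.I) := by
    rw [← Complex.exp_add, ellO_mul, abs_mul, Real.log_mul (abs_ne_zero.mpr hb) (abs_ne_zero.mpr hc)]
    congr 1; push_cast; ring
  rw [nu0O, nu0O, nu0O, map_mul, map_mul, hsign, mul_pow, hexp]
  ring

/-- `ν₀(1) = 1`. [folklore] -/
theorem nu0O_one (χ : MulChar (QuotMod q) ℂ) : nu0O χ 1 = 1 := by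
  simp [nu0O, MulChar.map_one]

/-- **`ν₀(−β) = ν₀(β)`** (`χ(−1)(−1)^s = 1`). [cite: HeathBrownActa2001, §9 p. 53] -/
theorem nu0O_neg (χ : MulChar (QuotMod q) ℂ) (β : 𝓞 K) : nu0O χ (-β) = nu0O χ β := by
  by_cases hβ : β = 0
  · rw [hβ, neg_zero]
  have hb := ellO_ne_zero hβ
  rw [nu0O, nu0O, map_neg, ellO_neg, abs_neg, neg_div, Complex.ofReal_neg, neg_pow,
    show -(toQuotMod q β) = (-1) * toQuotMod q β by ring, map_mul, mulChar_neg_one_eq]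
  have h1 : ((-1 : ℂ) ^ charSign χ) * ((-1 : ℂ) ^ charSign χ) = 1 := by
    rw [← mul_pow, neg_one_mul, neg_neg, one_pow]
  linear_combination (χ (toQuotMod q β) * ((ellO β / |ellO β| : ℝ) : ℂ) ^ charSign χ *
    Complex.exp ((-(charAngle χ * (Real.log |ellO β| / unitLog)) : ℝ) * Complex.I)) * h1

/-- **`ν₀(u_E) = 1`** (`χ(u_E) = e^{it}` cancels `exp(−it)`; `u_E > 0`). [cite: HeathBrownActa2001, §9 p. 53] -/
theorem nu0O_unitGen (hq : 1 ≤ q) (χ : MulChar (QuotMod q) ℂ) : nu0O χ (unitGen : 𝓞 K) = 1 := by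
  have hE := unitE_pos
  rw [nu0O, mulChar_unitGen_eq hq, ellO_unitGen, abs_of_pos hE, div_self hE.ne', Complex.ofReal_one,
    one_pow, mul_one, show Real.log unitE / unitLog = 1 from div_self unitLog_pos.ne', mul_one,
    ← Complex.exp_add]
  convert Complex.exp_zero using 2
  push_cast; ring

/-- **`ν₀` is `1` on units.** [cite: HeathBrownActa2001, §9 p. 53] -/
theorem nu0O_units (hq : 1 ≤ q) (χ : MulChar (QuotMod q) ℂ) (u : (𝓞 K)ˣ) : nu0O χ (u : 𝓞 K) = 1 :=
  apply_units_eq_one (fun _ _ => nu0O_mul χ) (nu0O_one χ) (nu0O_neg χ) (nu0O_unitGen hq χ) u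

/-- `|ν₀(β)| ≤ 1`. [cite: HeathBrownActa2001, §9 p. 53] -/
theorem norm_nu0O_le (hq : 1 ≤ q) (χ : MulChar (QuotMod q) ℂ) (β : 𝓞 K) : ‖nu0O χ β‖ ≤ 1 := by
  rw [nu0O, norm_mul, norm_mul, Complex.norm_exp_ofReal_mul_I, mul_one, norm_pow, Complex.norm_real,
    Real.norm_eq_abs]
  have h1 : ‖χ (toQuotMod q β)‖ ≤ 1 := by
    by_cases hu : IsUnit (toQuotMod q β)
    · obtain ⟨x, hx⟩ := hu
      rw [← hx, norm_mulChar_apply_units hq]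
    · rw [MulChar.map_nonunit χ hu, norm_zero]; exact zero_le_one
  have h2 : (abs (ellO β / |ellO β|)) ^ charSign χ ≤ 1 := by
    apply pow_le_one₀ (abs_nonneg _)
    rw [abs_div, abs_abs]
    exact div_self_le_one _
  exact mul_le_one₀ h1 (by positivity) h2

/-- `ν₀(β) = 0` unless `β` is a unit modulo `q`. [cite: HeathBrownActa2001, §9 p. 53] -/
theorem nu0O_eq_zero_of_not_isUnit (χ : MulChar (QuotMod q) ℂ) {β : 𝓞 K} (h : ¬ IsUnit (toQuotMod q β)) :
    nu0O χ β = 0 := by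
  rw [nu0O, MulChar.map_nonunit χ h, zero_mul, zero_mul]

/-! ### The characters `ν^{(j,k)} = ν₀ν₁^jν₂^k` of the ideals of `𝓞_K` -/

/-- **`ν^{(j,k)}(β) = ν₀(β)ν₁(β)^jν₂(β)^k`** on `𝓞_K` (`j, k ∈ ℤ`). [cite: HeathBrownActa2001, §9 p. 54] -/
def nuO (χ : MulChar (QuotMod q) ℂ) (j k : ℤ) (β : 𝓞 K) : ℂ := nu0O χ β * nu1O β ^ j * nu2O β ^ k

/-- `ν^{(j,k)}` is multiplicative on `𝓞_K ∖ {0}`. [cite: HeathBrownActa2001, §9 p. 54] -/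
theorem nuO_mul (χ : MulChar (QuotMod q) ℂ) (j k : ℤ) {β γ : 𝓞 K} (hβ : β ≠ 0) (hγ : γ ≠ 0) :
    nuO χ j k (β * γ) = nuO χ j k β * nuO χ j k γ := by
  rw [nuO, nuO, nuO, nu0O_mul χ hβ hγ, nu1O_mul hβ hγ, nu2O_mul hβ hγ, mul_zpow, mul_zpow]; ring

/-- `ν^{(j,k)}` is `1` on units (`q ≥ 1`). [cite: HeathBrownActa2001, §9 p. 54] -/
theorem nuO_units (hq : 1 ≤ q) (χ : MulChar (QuotMod q) ℂ) (j k : ℤ) (u : (𝓞 K)ˣ) :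
    nuO χ j k (u : 𝓞 K) = 1 := by
  rw [nuO, nu0O_units hq, nu1O_units, nu2O_units, one_zpow, one_zpow, mul_one, mul_one]

/-- `ν^{(j,k)}(uβ) = ν^{(j,k)}(β)` for a unit `u`. [cite: HeathBrownActa2001, §9 p. 53] -/
theorem nuO_units_mul (hq : 1 ≤ q) (χ : MulChar (QuotMod q) ℂ) (j k : ℤ) (u : (𝓞 K)ˣ) (β : 𝓞 K) :
    nuO χ j k ((u : 𝓞 K) * β) = nuO χ j k β := by
  by_cases hβ : β = 0
  · rw [hβ, mul_zero]
  rw [nuO_mul χ j k (Units.ne_zero u) hβ, nuO_units hq, one_mul]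

/-- `coordVec 0 = (0, 0, 0)` (the same fact, as `coordVec 0 = 0`, is `coordVec_zero` of
`HeathBrownCubicTypeIIGenerators`, on another import branch). [folklore] -/
@[simp] theorem coordVec_zero' : coordVec (0 : 𝓞 K) = ((0 : ℤ), (0 : ℤ), (0 : ℤ)) :=
  coordElt_injective (by rw [coordElt_coordVec]; simp [coordElt])

/-- `ν₁(0) = 0` (junk value at `0`, never used). [folklore] -/
theorem nu1O_zero : nu1O (0 : 𝓞 K) = 0 := by
  simp [nu1O, realVec, nu1, castVec, ell]

/-- `|ν₁(β)^j| ≤ 1`. [folklore] -/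
theorem norm_nu1O_zpow_le (β : 𝓞 K) (j : ℤ) : ‖nu1O β ^ j‖ ≤ 1 := by
  by_cases hβ : β = 0
  · rw [hβ, nu1O_zero]
    rcases eq_or_ne j 0 with rfl | hj
    · simp
    · rw [zero_zpow j hj, norm_zero]; exact zero_le_one
  · rw [norm_zpow, norm_nu1O hβ, one_zpow]

/-- `|ν^{(j,k)}(β)| ≤ 1`. [cite: HeathBrownActa2001, §9 p. 53] -/
theorem norm_nuO_le (hq : 1 ≤ q) (χ : MulChar (QuotMod q) ℂ) (j k : ℤ) (β : 𝓞 K) : ‖nuO χ j k β‖ ≤ 1 := by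
  rw [nuO, norm_mul, norm_mul, norm_zpow (nu2O β), norm_nu2O, one_zpow, mul_one]
  exact mul_le_one₀ (norm_nu0O_le hq χ β) (norm_nonneg _) (norm_nu1O_zpow_le β j)

/-! ### From `𝓞_K` to ideals: `K` has class number one -/

/-- A generator of the (principal) ideal `S` of `𝓞_K = ℤ[2^{1/3}]` (a PID,
`CubeRootTwoFieldPID.instIsPrincipalIdealRing`). [folklore] -/
def idealGen (S : Ideal (𝓞 K)) : 𝓞 K := Submodule.IsPrincipal.generator S

/-- `(idealGen S) = S`. [folklore] -/
theorem span_idealGen (S : Ideal (𝓞 K)) : Ideal.span {idealGen S} = S := Ideal.span_singleton_generator S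

/-- `idealGen S ≠ 0` for `S ≠ 0`. [folklore] -/
theorem idealGen_ne_zero {S : Ideal (𝓞 K)} (hS : S ≠ ⊥) : idealGen S ≠ 0 := fun h =>
  hS ((Submodule.IsPrincipal.eq_bot_iff_generator_eq_zero S).mpr h)

/-- The generator of `(β)` is an associate of `β`. [folklore] -/
theorem associated_idealGen_span (β : 𝓞 K) : Associated (idealGen (Ideal.span {β})) β :=
  Ideal.span_singleton_eq_span_singleton.mp (span_idealGen _)

/-- The generator of `ST` is an associate of the product of the generators. [folklore] -/
theorem associated_idealGen_mul (S T : Ideal (𝓞 K)) : Associated (idealGen (S * T)) (idealGen S * idealGen T) := by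
  apply Ideal.span_singleton_eq_span_singleton.mp
  rw [span_idealGen, ← Ideal.span_singleton_mul_span_singleton, span_idealGen, span_idealGen]

/-- The generator of `(1)` is a unit. [folklore] -/
theorem isUnit_idealGen_top : IsUnit (idealGen (⊤ : Ideal (𝓞 K))) := by
  rw [← Ideal.span_singleton_eq_top, span_idealGen]

/-- **Lifting a unit-invariant multiplicative function from `𝓞_K ∖ {0}` to the non-zero ideals**
(class number one): `S ↦ f(generator of S)`, and `0 ↦ 0`. [folklore] -/
def liftIdeal (f : 𝓞 K → ℂ) (S : Ideal (𝓞 K)) : ℂ := by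
  classical
  exact if S = ⊥ then 0 else f (idealGen S)

variable {f : 𝓞 K → ℂ}

/-- `liftIdeal f 0 = 0`. [folklore] -/
theorem liftIdeal_bot (f : 𝓞 K → ℂ) : liftIdeal f ⊥ = 0 := by simp [liftIdeal]

/-- For `S ≠ 0`: `liftIdeal f S = f (idealGen S)`. [folklore] -/
theorem liftIdeal_of_ne_bot (f : 𝓞 K → ℂ) {S : Ideal (𝓞 K)} (hS : S ≠ ⊥) : liftIdeal f S = f (idealGen S) := by
  simp [liftIdeal, hS]

/-- **`liftIdeal f (β) = f(β)`** for `β ≠ 0` when `f` is invariant under units. [folklore] -/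
theorem liftIdeal_span (hunit : ∀ (u : (𝓞 K)ˣ) (β : 𝓞 K), f ((u : 𝓞 K) * β) = f β) {β : 𝓞 K} (hβ : β ≠ 0) :
    liftIdeal f (Ideal.span {β}) = f β := by
  rw [liftIdeal_of_ne_bot f (by rwa [Ne, Ideal.span_singleton_eq_bot])]
  obtain ⟨u, hu⟩ := associated_idealGen_span β
  calc f (idealGen (Ideal.span {β})) = f ((u : 𝓞 K) * idealGen (Ideal.span {β})) := (hunit u _).symm
    _ = f β := by rw [mul_comm, hu]

/-- **The lift as a homomorphism `Ideal(𝓞_K) →*₀ ℂ`** for `f` multiplicative on `𝓞_K ∖ {0}`, `f(1) = 1`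
and `f` invariant under units. [folklore] -/
def liftIdealHom (f : 𝓞 K → ℂ) (hmul : ∀ β γ : 𝓞 K, β ≠ 0 → γ ≠ 0 → f (β * γ) = f β * f γ)
    (hone : f 1 = 1) (hunit : ∀ (u : (𝓞 K)ˣ) (β : 𝓞 K), f ((u : 𝓞 K) * β) = f β) :
    Ideal (𝓞 K) →*₀ ℂ where
  toFun := liftIdeal f
  map_zero' := liftIdeal_bot f
  map_one' := by
    rw [Ideal.one_eq_top, liftIdeal_of_ne_bot f (by simp)]
    obtain ⟨u, hu⟩ := isUnit_idealGen_top
    rw [← hu, ← mul_one (u : 𝓞 K), hunit, hone]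
  map_mul' S T := by
    by_cases hS : S = ⊥
    · rw [hS, Submodule.bot_mul, liftIdeal_bot, zero_mul]
    by_cases hT : T = ⊥
    · rw [hT, Submodule.mul_bot, liftIdeal_bot, mul_zero]
    have hST : S * T ≠ ⊥ := mul_ne_zero hS hT
    rw [liftIdeal_of_ne_bot f hST, liftIdeal_of_ne_bot f hS, liftIdeal_of_ne_bot f hT]
    obtain ⟨u, hu⟩ := (associated_idealGen_mul S T).symm
    rw [← hu, mul_comm _ (u : 𝓞 K), hunit, hmul _ _ (idealGen_ne_zero hS) (idealGen_ne_zero hT)]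

/-- Values of the lift. [folklore] -/
theorem liftIdealHom_apply (hmul : ∀ β γ : 𝓞 K, β ≠ 0 → γ ≠ 0 → f (β * γ) = f β * f γ)
    (hone : f 1 = 1) (hunit : ∀ (u : (𝓞 K)ˣ) (β : 𝓞 K), f ((u : 𝓞 K) * β) = f β) (S : Ideal (𝓞 K)) :
    liftIdealHom f hmul hone hunit S = liftIdeal f S := rfl

/-- **Heath-Brown's character `ν^{(j,k)} = ν₀ν₁^jν₂^k` on the ideals of `𝓞_K`** ("If `S` is an integral
ideal generated by `β`, we may then define `ν_i(S) = ν_i(β)`", p. 53; "`ν(S) = ν^{(j,k)}(S) = ν₀(S)ν₁(S)^jν₂(S)^k`",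
p. 54), as a homomorphism `Ideal(𝓞_K) →*₀ ℂ` (value `0` at the zero ideal, and at the ideals not coprime
to `q` through `χ`); parameters: the modulus `q ≥ 1`, a character `χ` of `(𝓞_K/(q))^×` (a `MulChar`,
extended by `0`), and `j, k ∈ ℤ`. [cite: HeathBrownActa2001, §9 (9.2) and p. 54] -/
def grossenChar (hq : 1 ≤ q) (χ : MulChar (QuotMod q) ℂ) (j k : ℤ) : Ideal (𝓞 K) →*₀ ℂ :=
  liftIdealHom (nuO χ j k) (fun _ _ => nuO_mul χ j k) (by rw [nuO, nu0O_one, nu1O_one, nu2O_one]; simp)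
    (nuO_units_mul hq χ j k)

/-- **`ν^{(j,k)}((β)) = ν₀(β)ν₁(β)^jν₂(β)^k`** for `β ≠ 0`. [cite: HeathBrownActa2001, §9 p. 53] -/
theorem grossenChar_span (hq : 1 ≤ q) (χ : MulChar (QuotMod q) ℂ) (j k : ℤ) {β : 𝓞 K} (hβ : β ≠ 0) :
    grossenChar hq χ j k (Ideal.span {β}) = nu0O χ β * nu1O β ^ j * nu2O β ^ k :=
  liftIdeal_span (nuO_units_mul hq χ j k) hβ

/-- `ν^{(j,k)}(S) = ν^{(j,k)}(idealGen S)` for `S ≠ 0`. [folklore] -/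
theorem grossenChar_of_ne_bot (hq : 1 ≤ q) (χ : MulChar (QuotMod q) ℂ) (j k : ℤ) {S : Ideal (𝓞 K)}
    (hS : S ≠ ⊥) : grossenChar hq χ j k S = nuO χ j k (idealGen S) :=
  liftIdeal_of_ne_bot _ hS

/-- `ν^{(j,k)}(0) = 0`. [folklore] -/
theorem grossenChar_bot (hq : 1 ≤ q) (χ : MulChar (QuotMod q) ℂ) (j k : ℤ) :
    grossenChar hq χ j k ⊥ = 0 := liftIdeal_bot _

/-- **`|ν^{(j,k)}(S)| ≤ 1`.** [cite: HeathBrownActa2001, §9 p. 53] -/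
theorem norm_grossenChar_le (hq : 1 ≤ q) (χ : MulChar (QuotMod q) ℂ) (j k : ℤ) (S : Ideal (𝓞 K)) :
    ‖grossenChar hq χ j k S‖ ≤ 1 := by
  by_cases hS : S = ⊥
  · rw [hS, grossenChar_bot, norm_zero]; exact zero_le_one
  · rw [grossenChar_of_ne_bot hq χ j k hS]; exact norm_nuO_le hq χ j k _

/-- `x` is a unit modulo `q` iff `x` and `q` are coprime in `𝓞_K`. [folklore] -/
theorem isUnit_toQuotMod_iff (x : 𝓞 K) : IsUnit (toQuotMod q x) ↔ IsCoprime x ((q : ℕ) : 𝓞 K) := by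
  constructor
  · intro h
    obtain ⟨w, hw⟩ := isUnit_iff_exists_inv.mp h
    obtain ⟨a, rfl⟩ := Ideal.Quotient.mk_surjective w
    rw [← map_mul, ← map_one (toQuotMod q), Ideal.Quotient.eq, Ideal.mem_span_singleton'] at hw
    obtain ⟨b, hb⟩ := hw
    exact ⟨a, -b, by linear_combination -hb⟩
  · rintro ⟨a, b, h⟩
    refine isUnit_iff_exists_inv.mpr ⟨toQuotMod q a, ?_⟩
    have hq0 : toQuotMod q ((q : ℕ) : 𝓞 K) = 0 :=
      Ideal.Quotient.eq_zero_iff_mem.mpr (Ideal.mem_span_singleton_self _)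
    have := congrArg (toQuotMod q) h
    rw [map_add, map_mul, map_mul, hq0, mul_zero, add_zero, map_one, mul_comm] at this
    exact this

/-- An ideal `S` is coprime to `(q)` iff its generator is a unit modulo `q`. [folklore] -/
theorem isUnit_toQuotMod_idealGen_iff (S : Ideal (𝓞 K)) :
    IsUnit (toQuotMod q (idealGen S)) ↔ S ⊔ Ideal.span {((q : ℕ) : 𝓞 K)} = ⊤ := by
  rw [isUnit_toQuotMod_iff, ← Ideal.sup_eq_top_iff_isCoprime, span_idealGen]

/-- **`ν^{(j,k)}(S) = 0` unless `S` is coprime to `q`.** [cite: HeathBrownActa2001, §9 p. 53] -/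
theorem grossenChar_eq_zero_of_not_coprime (hq : 1 ≤ q) (χ : MulChar (QuotMod q) ℂ) (j k : ℤ)
    {S : Ideal (𝓞 K)} (hS : S ⊔ Ideal.span {((q : ℕ) : 𝓞 K)} ≠ ⊤) : grossenChar hq χ j k S = 0 := by
  by_cases h0 : S = ⊥
  · rw [h0, grossenChar_bot]
  rw [grossenChar_of_ne_bot hq χ j k h0, nuO, nu0O_eq_zero_of_not_isUnit χ, zero_mul, zero_mul]
  rwa [isUnit_toQuotMod_idealGen_iff]

/-- **"Trivial" characters** (p. 54): "we shall say that the character `ν(S)` is trivial if it takes the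
value `1` whenever `S` is coprime to `q`". [cite: HeathBrownActa2001, §9 p. 54] -/
def IsTrivialMod (q : ℕ) (ν : Ideal (𝓞 K) →*₀ ℂ) : Prop :=
  ∀ S : Ideal (𝓞 K), S ≠ ⊥ → S ⊔ Ideal.span {((q : ℕ) : 𝓞 K)} = ⊤ → ν S = 1

/-- For the trivial character `χ₀ mod q`: `s = 0`. [folklore] -/
theorem charSign_one : charSign (1 : MulChar (QuotMod q) ℂ) = 0 := by
  rw [charSign, if_pos (MulChar.one_apply isUnit_one.neg)]

/-- For the trivial character `χ₀ mod q`: `t = 0`. [folklore] -/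
theorem charAngle_one : charAngle (1 : MulChar (QuotMod q) ℂ) = 0 := by
  rw [charAngle, MulChar.one_apply ((Units.isUnit unitGen).map _), Complex.arg_one]

/-- For `χ = χ₀`: `ν₀(β) = 1` if `β` is a unit mod `q`. [cite: HeathBrownActa2001, §9 p. 54] -/
theorem nu0O_one_apply {β : 𝓞 K} (hβ : IsUnit (toQuotMod q β)) : nu0O (1 : MulChar (QuotMod q) ℂ) β = 1 := by
  rw [nu0O, MulChar.one_apply hβ, charSign_one, charAngle_one, pow_zero]
  simp

/-- **The character `ν^{(0,0)}` built from `χ₀` is trivial**: it is `1` on every ideal coprime to `q`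
("This corresponds to having the trivial character `χ` modulo `q`, letting `s = t = 0` in the definition
of `ν₀`, and taking `j = k = 0`", p. 54 — the easy direction). [cite: HeathBrownActa2001, §9 p. 54] -/
theorem isTrivialMod_grossenChar_one (hq : 1 ≤ q) : IsTrivialMod q (grossenChar hq (1 : MulChar (QuotMod q) ℂ) 0 0) := by
  intro S h0 hS
  rw [grossenChar_of_ne_bot hq _ 0 0 h0, nuO, zpow_zero, zpow_zero, mul_one, mul_one,
    nu0O_one_apply ((isUnit_toQuotMod_idealGen_iff S).mpr hS)]

end Literature.NumberTheory.Sieve.CubicSieve
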